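import Summits.Ventures.GridStability.Lyapunov.StructurePreservingRoa
import Summits.Ventures.GridStability.Models.StructurePreservingClassical
import HarnessLib

/-!
# GridStability/Lyapunov/ClassicalSwingRoa — local asymptotic stability of the synchronous
# equilibrium of the LOSSLESS classical multimachine model (energy route, absolute coordinates)

Cell `gridfusion` (LADDER-GRIDFUSION), `plan/PARTITION.md` §0 row `Lyapunov/`, A5″; seat
gridfusion-lyap-1 (g2). Corollary of `Lyapunov/StructurePreservingRoa.lean` (Bergen–Hill LAS theorem
for MODEL MV-3, this seat) through model-2's dictionary `Models/StructurePreservingClassical.lean`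
(p464711: model-1's LOSSLESS network-reduced classical model `ClassicalSwing` [cite: AndersonFouad1977,
§2.9 eqs (2.53)–(2.57)]; [cite: SauerPai1998, §7.9.3 eqs (7.209)–(7.216)] IS the structure-preserving
data `Params.ofClassical p` with every node a generator, `b = C = EᵢEⱼBᵢⱼ`, `P⁰ = P − E²Gᵢᵢ`
[cite: Padiyar2013, §2.2.4 Remarks 1–2]; at an equilibrium `ω₀ = 0`, `P̄ = P⁰`, and model-1's
classical transient energy [cite: SauerPai1998, §9] equals Bergen–Hill's topological energy,
`ofClassical_energy`). This is lit-6's open successor item (a) of `lit/6-REGISTER.md` §9.7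
(«lossless n-machine R-EN in reference coordinates … uniqueness for n ≥ 3 needs thought»), settled
WITHOUT reference coordinates: the rotational degeneracy of the energy is removed by the invariant
momentum level set `Σ Mᵢωᵢ + Σ Dᵢδᵢ = Σ Dᵢδᵢˢ` (model-2's `StructurePreservingInvariant`), and
uniqueness of the equilibrium on it by the monotonicity argument of
`eq_of_isSyncEquilibrium_of_momentum_eq`.

STATEMENT (`ClassicalSwingRoa.sublevel_subset_regionOfAttraction`; MODELLED column, MODEL MV-2L =
lossless reduced network, classical machines, damping `Dᵢ > 0` at every machine): for symmetric `B`,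
couplings `Cᵢⱼ ≥ 0` with `Cᵢⱼ ≥ β > 0` on the edges of a PRECONNECTED coupling graph, an equilibrium
`δˢ` with `|δᵢˢ − δⱼˢ| ≤ θ < π/2` on coupled pairs, and a level `c < c⋆(θ, β) = g(θ)·β·(π/2 − θ)²/4`:
EVERY solution `γ = (δ, ω)` of model-1's `M_cl` on all of `ℝ` whose initial state has every coupled
pair inside `|δᵢ − δⱼ| < π/2`, momentum `Σ Mᵢωᵢ(0) + Σ Dᵢδᵢ(0) = Σ Dᵢδᵢˢ` and classical energy
`V(γ 0) ≤ c` keeps the window and `V ≤ c` for all `t ≥ 0` and tends to `(δˢ, 0)`. A priori over all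
solutions; no flow object; no certificate (numerics-free energy route R-EN). THREE COLUMNS: no
sentence here says a grid is stable; «region of attraction» = the stated set of initial states OF
MODEL MV-2L is carried to the model's equilibrium. Not here: transfer conductances (MV-2, the G1.b
model of record — its injections carry `cos` terms and the energy is not a Lyapunov function), the
size of the best level set for given data (certificate / BoxCover job).
-/

noncomputable section

open Set Filter Topology Real
open Summit.Ventures.GridStability.Lyapunov.StructurePreserving
open Summit.Ventures.GridStability.Models.StructurePreserving
open Summit.Ventures.GridStability.Models.StructurePreserving.Params

namespace Summit.Ventures.GridStability.Lyapunov.ClassicalSwingRoa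

open Summit.Ventures.GridStability.Models

variable {n : ℕ}

/-- **The structure-preserving phase field of `ofClassical p` IS model-1's classical vector field**
(lossless, symmetric `B`, an equilibrium exists so that `ω₀ = 0` and `P̄ = P⁰`): every node is a
generator, `δ̇ᵢ = ωᵢ` and `ω̇ᵢ = (P̄ᵢ − Dᵢωᵢ − fᵢ(δ))/Mᵢ = (Pᵢ − P_ei(δ) − Dᵢωᵢ)/Mᵢ`
(`ofClassical_pe`: `fᵢ = P_ei − Eᵢ²Gᵢᵢ`). [folklore] -/
theorem phaseField_ofClassical (p : ClassicalSwing n) (hl : p.IsLossless)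
    (hB : ∀ i j, p.B i j = p.B j i) {δs : Fin n → ℝ} (hs : p.IsEquilibrium δs)
    (x : ClassicalSwing.State n) :
    phaseField (Params.ofClassical p) x = p.field x := by
  refine Prod.ext (funext fun i => ?_) (funext fun i => ?_)
  · rw [phaseField_fst_of_mem _ x (by simp)]
    rfl
  · rw [phaseField_snd_of_mem _ x (by simp), Params.Pbar_ofClassical_eq p hl hB hs i,
      Params.ofClassical_pe p hl]
    simp only [Params.ofClassical_P0, Params.ofClassical_M, Params.ofClassical_D,
      ClassicalSwing.field]
    ring

/-- **Local asymptotic stability of the synchronous equilibrium of the lossless classical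
multimachine model, with a region-of-attraction estimate, in ABSOLUTE rotor angles** (MODEL MV-2L;
energy route, a priori over all solutions). Data: `p : ClassicalSwing n` lossless with symmetric `B`,
`Mᵢ, Dᵢ > 0`, `n ≠ 0`, couplings `Cᵢⱼ = EᵢEⱼBᵢⱼ ≥ 0` bounded below by `β > 0` on the edges of a
preconnected coupling graph; an equilibrium `δˢ` (`P_ei(δˢ) = Pᵢ`) with `|δᵢˢ − δⱼˢ| ≤ θ < π/2` on
coupled pairs; `c < c⋆(θ, β)`. For every solution `γ` of `M_cl` on `ℝ` (model-1's `IsSolutionOn γ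
univ`) with initial window `|δᵢ(0) − δⱼ(0)| < π/2` on coupled pairs, momentum
`Σ Mᵢωᵢ(0) + Σ Dᵢδᵢ(0) = Σ Dᵢδᵢˢ` and classical energy `V(γ 0) ≤ c` [cite: SauerPai1998, §9]:
the window and `V ≤ c` persist for `t ≥ 0`, and `γ(t) → (δˢ, 0)`. Proof: model-2's dictionary
(`wellFormed_ofClassical`, `isSyncEquilibrium_ofClassical`, `ofClassical_energy`,
`phaseField_ofClassical`) and `Lyapunov.StructurePreserving.sublevel_subset_regionOfAttraction`.
No sentence here says a grid is stable. [folklore] -/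
theorem sublevel_subset_regionOfAttraction (p : ClassicalSwing n) (hl : p.IsLossless)
    (hB : ∀ i j, p.B i j = p.B j i) (hM : ∀ i, 0 < p.M i) (hD : ∀ i, 0 < p.D i) (hn : n ≠ 0)
    (hconn : (Params.ofClassical p).couplingGraph.Preconnected) (hC : ∀ i j, 0 ≤ p.Ccoef i j)
    {β : ℝ} (hβ : 0 < β)
    (hβb : ∀ i j, (Params.ofClassical p).couplingGraph.Adj i j → β ≤ p.Ccoef i j)
    {δs : Fin n → ℝ} {θ : ℝ} (hθ0 : 0 ≤ θ) (hθ : θ < π / 2)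
    (h0 : ∀ i j, p.Ccoef i j ≠ 0 → |δs i - δs j| ≤ θ) (hs : p.IsEquilibrium δs)
    {c : ℝ} (hc : c < levelBound θ β) {γ : ℝ → ClassicalSwing.State n} (hγ : p.IsSolutionOn γ univ)
    (hwin : ∀ i j, p.Ccoef i j ≠ 0 → |(γ 0).1 i - (γ 0).1 j| < π / 2)
    (hL : ∑ i, p.M i * (γ 0).2 i + ∑ i, p.D i * (γ 0).1 i = ∑ i, p.D i * δs i)
    (hV : p.energy δs (γ 0) ≤ c) :
    (∀ t, 0 ≤ t → (∀ i j, p.Ccoef i j ≠ 0 → |(γ t).1 i - (γ t).1 j| < π / 2) ∧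
        p.energy δs (γ t) ≤ c) ∧
      Tendsto γ atTop (𝓝 (δs, 0)) := by
  have hwf : (Params.ofClassical p).WellFormed := Params.wellFormed_ofClassical p hM hD hB
  have hδ₀ : (Params.ofClassical p).IsSyncEquilibrium δs :=
    Params.isSyncEquilibrium_ofClassical p hl hB hs
  have hb : ∀ i j, 0 ≤ (Params.ofClassical p).b i j := fun i j => hC i j
  have hβb' : ∀ i j, (Params.ofClassical p).couplingGraph.Adj i j →
      β ≤ (Params.ofClassical p).b i j := fun i j hij => hβb i j hij
  have h0' : ∀ i j, (Params.ofClassical p).b i j ≠ 0 → |δs i - δs j| ≤ θ :=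
    fun i j hij => h0 i j hij
  -- the classical solution solves the structure-preserving phase field on every `[0, T]`
  have hX : ∀ T : ℝ, ∀ t ∈ Icc 0 T,
      HasDerivWithinAt γ (phaseField (Params.ofClassical p) (γ t)) (Icc 0 T) t :=
    fun T t _ => by
      rw [phaseField_ofClassical p hl hB hs (γ t)]
      exact (hγ t (mem_univ t)).mono (subset_univ _)
  -- energies agree
  have hE : ∀ x : ClassicalSwing.State n,
      phaseEnergy (Params.ofClassical p) δs x = p.energy δs x := fun x => by
    rw [phaseEnergy_apply, Params.ofClassical_energy p hl hB hs x.1 x.2]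
  -- the initial state lies in the sublevel piece
  have hy : γ 0 ∈ window (Params.ofClassical p) ∩ constraintSet (Params.ofClassical p) δs ∧
      phaseEnergy (Params.ofClassical p) δs (γ 0) ≤ c := by
    refine ⟨⟨fun i j hij => hwin i j hij, ?_, fun i hi => absurd (Finset.mem_univ i) ?_⟩, ?_⟩
    · show (Params.ofClassical p).momentum (γ 0).1 (γ 0).2
        = (Params.ofClassical p).momentum δs 0
      simp only [Params.momentum, Params.ofClassical_gen, Params.ofClassical_M,
        Params.ofClassical_D, Pi.zero_apply, mul_zero, Finset.sum_const_zero, zero_add]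
      exact hL
    · simp at hi
    · rw [hE]
      exact hV
  obtain ⟨-, hall⟩ := Lyapunov.StructurePreserving.sublevel_subset_regionOfAttraction hwf hn
    hconn hb hβ hβb' hθ0 hθ h0' hδ₀ hc hy
  obtain ⟨hstay, hlim⟩ := hall γ rfl hX
  refine ⟨fun t ht => ⟨fun i j hij => (hstay t ht).1.1 i j hij, ?_⟩, hlim⟩
  rw [← hE]
  exact (hstay t ht).2

end Summit.Ventures.GridStability.Lyapunov.ClassicalSwingRoa

end
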